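import Mathlib
import HarnessLib
import Summits.NavierStokesRegularity.NavierStokesRegularity.Theorems.PoloidalWindowRigidity.Negative.LocalTHEmptyFalseWithoutSlopeGradient

/-!
# Crux `PoloidalWindowRigidity` (K2, stmt-NavierStokesRegularity-19708) — negative side of the EXPONENTIAL-POLYNOMIAL
# sector theorem: `ExpPolySector_NoTwistingTHGerm` (THEOREM E, typed by K2-p5 g2) is FALSE WITHOUT ITS SLOPE-GRADIENT CLAUSE

Refuter seat ns-regularity-refuter1 g8 (cell ns-regularity-ideate, D-0081 §C; K-READ K-60 of
`Cruxes/PoloidalWindowRigidity/PolySector.lean`, K2-p5 g2, memo `POLY-SECTOR-K2p5.md` v4 §11), `--supports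
stmt-NavierStokesRegularity-19708`, negative side.

`ExpPolySector_NoTwistingTHGerm` = the binders of `stub_localTHEmpty` (`Cruxes/PoloidalWindowRigidity/Lines/local_rigidity.lean`
v1; machine-diffed equal) + ONE sector hypothesis `IsHorizExpPolynomialOn U u` (on every `(t,y₂)`-slice the velocity is an
exponential polynomial in `(y₀,y₁)` with a fixed finite complex spectrum and polynomial amplitudes) ⇒ `False`.  The memo's proof
(§9–§11) produces every contradiction in the form `r·(top amplitude)² = 0` with `r = −m′/(2m(m−1))`, i.e. it divides by the slope
gradient `∂_z μ`.  This file shows in the kernel that the point clause `deriv (μ p₀.1) (p₀.2 2) ≠ 0` is indeed LOAD-BEARING for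
THEOREM E exactly as it is for `stub_localTHEmpty` itself (`localTHEmpty_false_without_slopeGradient`, K-56): the two crossed
suction layers `crossField 2 1 0` (`u = (−e^{y₀+y₂}, 4 − ½e^{y₁−y₂}, 2 + e^{y₀+y₂} − ½e^{y₁−y₂})`, an exact steady Navier–Stokes
flow) lie IN THE EXPONENTIAL-POLYNOMIAL SECTOR — horizontal spectrum `{(0,0), (1,0), (0,1)}`, constant amplitudes `·e^{±y₂}`
(`CrossedLayers.isHorizExpPolynomialOn_crossField`) — and satisfy all four local (TH) laws with the constant slope `μ ≡ −1`,
datum `A ≡ 0`, twist `−1 ≠ 0` at the origin (K-56 package), while `∂_z μ ≡ 0`.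

* `expPolySector_false_without_slopeGradient` : `¬ (ExpPolySector_NoTwistingTHGerm with the clause deleted)` — stated inline,
  the binders VERBATIM and the sector hypothesis `IsHorizExpPolynomialOn U u` δ-UNFOLDED verbatim (the crux workfile
  `Cruxes/…/PolySector.lean` is not an importable library module; refuter1's probe `k60/W_polysector.lean` checks on the farm that
  the inline text is `Iff.rfl`-equal to the by-name statement with the clause deleted).

Reading for the census (memo §11.5 made kernel-checked): the finite-spectrum sector is NOT empty on the constant-slope stratum
`{μ_z = 0}`; THEOREM E's content is entirely in the power-law mechanism driven by `μ_z ≠ 0`.  (The POLYNOMIAL sector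
`IsHorizPolynomialOn` is a different matter: the layers are genuinely exponential; whether a twisting POLYNOMIAL (TH) Navier–Stokes
germ with constant slope exists is not decided here.)

WHAT THIS IS NOT: not a refutation of THEOREM E / `ExpPolySector_NoTwistingTHGerm` as typed (the witness violates the deleted
clause by design), not a statement about `hempty`, the line, or Navier–Stokes regularity.
-/

noncomputable section
-- the summit and its single sub-problem share the name (CONVENTIONS §1), as in every Theorems file
set_option linter.dupNamespace false

namespace Summit.NavierStokesRegularity.NavierStokesRegularity.Theorems.PoloidalWindowRigidity.Negative

open Set Function Filter Topology Metric Real InnerProductSpace WithLp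
open scoped Laplacian RealInnerProductSpace ContDiff BigOperators
open Literature.Analysis Literature.Analysis.FluidPDE

namespace CrossedLayers

/-- **The crossed suction layers lie in the exponential-polynomial sector** (`IsHorizExpPolynomialOn U (fun _ => crossField 2 1 0)`
of `Cruxes/PoloidalWindowRigidity/PolySector.lean`, unfolded, for EVERY space–time set `U`): on every horizontal plane
`crossField 2 1 0` is an exponential polynomial in `(y₀,y₁)` with the fixed spectrum `{(0,0),(1,0),(0,1)}` and constant (degree-0)
amplitudes depending on the height `y₂` only.  In the proof the complex amplitudes of the three modes at height `z`
are written as AFFINE functions of the frequency pair `σ` (interpolation through the three spectral points — no case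
distinction on `σ`): `u₀ = −e^{z}·e^{y₀}`, `u₁ = 4 − ½e^{−z}·e^{y₁}`, `u₂ = 2 + e^{z}·e^{y₀} − ½e^{−z}·e^{y₁}`. [folklore] -/
theorem isHorizExpPolynomialOn_crossField (U : Set (ℝ × EuclideanSpace ℝ (Fin 3))) :
    ∃ S : Finset (ℂ × ℂ), ∀ p ∈ U, ∀ i : Fin 3, ∃ P : ℂ × ℂ → MvPolynomial (Fin 2) ℂ, ∀ q ∈ U, q.1 = p.1 → q.2 2 = p.2 2 →
      (((fun _ : ℝ => crossField 2 1 0) q.1 q.2 i : ℝ) : ℂ) =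
        ∑ σ ∈ S, MvPolynomial.eval ![((q.2 0 : ℝ) : ℂ), ((q.2 1 : ℝ) : ℂ)] (P σ) *
          Complex.exp (σ.1 * ((q.2 0 : ℝ) : ℂ) + σ.2 * ((q.2 1 : ℝ) : ℂ)) := by
  classical
  refine ⟨{((0 : ℂ), (0 : ℂ)), ((1 : ℂ), (0 : ℂ)), ((0 : ℂ), (1 : ℂ))}, ?_⟩
  intro p _ i
  refine ⟨fun σ => MvPolynomial.C
    (![-(Complex.exp (p.2 2)) * σ.1,
       4 - 4 * σ.1 - (4 + Complex.exp (-(p.2 2 : ℂ)) / 2) * σ.2,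
       2 - 2 * σ.1 - 2 * σ.2 + Complex.exp (p.2 2) * σ.1 - Complex.exp (-(p.2 2 : ℂ)) / 2 * σ.2] i), ?_⟩
  intro q _ _ h2
  have h01 : ((0 : ℂ), (0 : ℂ)) ∉ ({((1 : ℂ), (0 : ℂ)), ((0 : ℂ), (1 : ℂ))} : Finset (ℂ × ℂ)) := by simp
  have h02 : ((1 : ℂ), (0 : ℂ)) ∉ ({((0 : ℂ), (1 : ℂ))} : Finset (ℂ × ℂ)) := by simp
  rw [Finset.sum_insert h01, Finset.sum_insert h02, Finset.sum_singleton]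
  simp only [MvPolynomial.eval_C, ← h2]
  fin_cases i
  · simp [E₁, E₃, Complex.ofReal_exp, Complex.exp_add]
    ring
  · simp [E₂, Complex.ofReal_exp, Complex.exp_sub, Complex.exp_neg]
    ring
  · simp [E₁, E₂, E₃, Complex.ofReal_exp, Complex.exp_add, Complex.exp_sub, Complex.exp_neg]
    ring

end CrossedLayers

open CrossedLayers

/-- **THEOREM E WITHOUT `∂_z μ ≠ 0` IS FALSE.**  The negated statement is the text of
`…Cruxes.PoloidalWindowRigidity.PolySector.ExpPolySector_NoTwistingTHGerm` (K2-p5 g2) VERBATIM — binders = `stub_localTHEmpty`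
(`Lines/local_rigidity.lean` v1) + the sector hypothesis `IsHorizExpPolynomialOn U u` (δ-unfolded) — with the single point clause
`deriv (μ p₀.1) (p₀.2 2) ≠ 0 →` deleted; the crossed suction layers `crossField 2 1 0` with constant slope `μ ≡ −1` and `A ≡ 0`
satisfy every remaining hypothesis on `U = ℝ × ℝ³`, `p₀ = (0,0)`.  Any proof of THEOREM E must use the slope-gradient clause
at the base point (the memo's proof does: every contradiction is `r·(top)² = 0`, `r = −m′/(2m(m−1))`). [folklore] -/
theorem expPolySector_false_without_slopeGradient :
    ¬ (∀ (u : ℝ → EuclideanSpace ℝ (Fin 3) → EuclideanSpace ℝ (Fin 3)) (μ A : ℝ → ℝ → ℝ)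
        (U : Set (ℝ × EuclideanSpace ℝ (Fin 3))) (p₀ : ℝ × EuclideanSpace ℝ (Fin 3)),
        IsOpen U → p₀ ∈ U →
        AnalyticOnNhd ℝ (Function.uncurry u) U →
        (∀ p ∈ U, AnalyticAt ℝ (Function.uncurry μ) (p.1, p.2 2)) →
        (∀ p ∈ U, AnalyticAt ℝ (Function.uncurry A) (p.1, p.2 2)) →
        (∀ p ∈ U, fderiv ℝ (u p.1) p.2 (EuclideanSpace.single 0 1) 1 = fderiv ℝ (u p.1) p.2 (EuclideanSpace.single 1 1) 0) →
        (∀ p ∈ U, fderiv ℝ (u p.1) p.2 (EuclideanSpace.single 0 1) 0 + fderiv ℝ (u p.1) p.2 (EuclideanSpace.single 1 1) 1 +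
          fderiv ℝ (u p.1) p.2 (EuclideanSpace.single 2 1) 2 = 0) →
        (∀ p ∈ U, ∀ b : Fin 3, b ≠ 2 →
          fderiv ℝ (u p.1) p.2 (EuclideanSpace.single 2 1) b =
            μ p.1 (p.2 2) * fderiv ℝ (u p.1) p.2 (EuclideanSpace.single b 1) 2) →
        (∀ p ∈ U,
          (1 - μ p.1 (p.2 2)) *
              (deriv (fun s => u s p.2 2) p.1 + fderiv ℝ (fun y => u p.1 y 2) p.2 (u p.1 p.2)
                - Δ (fun y => u p.1 y 2) p.2) =
            A p.1 (p.2 2) + (deriv (fun s => μ s (p.2 2)) p.1 - deriv (deriv (μ p.1)) (p.2 2)) * u p.1 p.2 2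
              + deriv (μ p.1) (p.2 2) / 2 * u p.1 p.2 2 ^ 2
              - 2 * deriv (μ p.1) (p.2 2) * fderiv ℝ (u p.1) p.2 (EuclideanSpace.single 2 1) 2) →
        -- the sector hypothesis `IsHorizExpPolynomialOn U u`, unfolded
        (∃ S : Finset (ℂ × ℂ), ∀ p ∈ U, ∀ i : Fin 3, ∃ P : ℂ × ℂ → MvPolynomial (Fin 2) ℂ, ∀ q ∈ U, q.1 = p.1 → q.2 2 = p.2 2 →
          ((u q.1 q.2 i : ℝ) : ℂ) =
            ∑ σ ∈ S, MvPolynomial.eval ![((q.2 0 : ℝ) : ℂ), ((q.2 1 : ℝ) : ℂ)] (P σ) *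
              Complex.exp (σ.1 * ((q.2 0 : ℝ) : ℂ) + σ.2 * ((q.2 1 : ℝ) : ℂ))) →
        fderiv ℝ (fun y => fderiv ℝ (u p₀.1) y (EuclideanSpace.single 2 1) 2) p₀.2 (EuclideanSpace.single 0 1) *
              fderiv ℝ (u p₀.1) p₀.2 (EuclideanSpace.single 1 1) 2 -
            fderiv ℝ (fun y => fderiv ℝ (u p₀.1) y (EuclideanSpace.single 2 1) 2) p₀.2 (EuclideanSpace.single 1 1) *
              fderiv ℝ (u p₀.1) p₀.2 (EuclideanSpace.single 0 1) 2 ≠ 0 →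
        μ p₀.1 (p₀.2 2) ≠ 0 → μ p₀.1 (p₀.2 2) ≠ 1 → False) := by
  intro h
  refine h (fun _ => crossField 2 1 0) (fun _ _ => -1) (fun _ _ => 0) univ (0, 0) isOpen_univ (mem_univ _)
    (fun q _ => ((contDiff_crossField 2 1 0 (n := ω)).contDiffAt.analyticAt).comp analyticAt_snd)
    (fun _ _ => analyticAt_const) (fun _ _ => analyticAt_const) (fun p _ => ?_) (fun p _ => ?_) (fun p _ k hk => ?_)
    (fun p _ => ?_) (isHorizExpPolynomialOn_crossField univ) ?_ (by norm_num) (by norm_num)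
  · -- poloidal `∂₀u₁ = ∂₁u₀` (both vanish)
    beta_reduce
    rw [fderiv_crossField_single, fderiv_crossField_single]
    simp [jac]
  · -- divergence free
    beta_reduce
    rw [fderiv_crossField_single, fderiv_crossField_single, fderiv_crossField_single]
    simp [jac]
    ring
  · -- proportional shear with `μ = −1`
    beta_reduce
    fin_cases k
    · exact (proportionalShear_crossField 2 1 0 p.2).1
    · exact (proportionalShear_crossField 2 1 0 p.2).2
    · exact absurd rfl hk
  · -- the (TH) vertical momentum law, `A = 2·2·0·e^{2z} = 0`
    have h := thLaw_crossField 2 1 0 p.1 p.2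
    beta_reduce at h
    beta_reduce
    rw [h]
    ring
  · -- twisting at the origin: `−½·E₂·(2E₁) = −1 ≠ 0`
    beta_reduce
    rw [twist_crossField]
    simp [E₁, E₂, E₃]

end Summit.NavierStokesRegularity.NavierStokesRegularity.Theorems.PoloidalWindowRigidity.Negative

end
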